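import Literature.NumberTheory.EllipticCurves.McCallum1991.HigherLevelKolyvaginClasses
import Literature.NumberTheory.EllipticCurves.HeegnerPointsKolyvaginPrimaryCebotarevProofs
import Literature.NumberTheory.EllipticCurves.HeegnerPointsKolyvaginPrimaryCongruenceProofs
import Literature.NumberTheory.EllipticCurves.IsogenyFrobeniusTraceProofs
import Literature.NumberTheory.EllipticCurves.NonvanishingTwistsWaldspurgerOfHoffsteinLuo
import Literature.NumberTheory.Automorphic.ChebotarevArtinRepHolds
import Literature.NumberTheory.EllipticCurves.WeilPairingProofs
import HarnessLib

/-!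
# McCallum 1991, Cor. 3.2 at level `p^M` — the named fact
# `McCallum1991.cor32_eigenclasses_infinite_primes_localOrder` PROVED

W. G. McCallum, *Kolyvagin's work on Shafarevich–Tate groups*, LMS LN 153 (1991), §3 Cor. 3.2
(p. 299). The sibling `McCallum1991/HigherLevelKolyvaginClasses.lean` vendors Cor. 3.2 at level `p^M`
for `τ`-eigenclasses as a named fact (`def … : Prop`, no `_holds`), consumed as the hypothesis `h32` of
the road-K theorems of the cell `bsd-jet` (`JET.exists_kolyvaginPrime_addOrderOf_localization_eq_of_cor32`,
`JET.tamagawaExponent_le_mInfty_of_rowData`). This file DISCHARGES it: the tree already proves Cor. 3.2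
at level `p^M` from the Čebotarev density theorem and the Weil pairing
(`McCallum1991_cor_3_2_pow_of_chebotarev`, file `HeegnerPointsKolyvaginPrimaryCebotarevProofs`, fed with
`Automorphic.chebotarev_artinRep_holds` and `exists_weilPairing_holds`), in the shape «above every bound
`b` there is a Kolyvagin prime `ℓ` (Gross's (3.1)–(3.2) at level `p^M`: `IsKolyvaginPrime N W K p ℓ ∧
FrobEqFrobInfty W K (p^M) ℓ`) with `ord c_{i,λ} = p^{N_i}`». The translation to the fact's shape is
bookkeeping: (i) "above every bound" ⟹ `Set.Infinite`; (ii) `Frob(ℓ) = Frob(∞)` on `K(E_{p^M})` ⟹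
McCallum's congruences `p^M ∣ ℓ + 1`, `p^M ∣ a_ℓ` (`pow_dvd_add_one_of_frobEqFrobInfty`,
`pow_dvd_frobeniusTraceAt_of_frobEqFrobInfty` at a place of good reduction — the bound is taken above
`N_E`), i.e. `Zhang2014.IsKolyvaginPrime ∧ M ≤ Zhang2014.kolyvaginIndex`; (iii) the independence
*"`ord c_i` divides `a_i`"* ⟺ `a_i c_i = 0`; (iv) `ord c_{i,λ} = p^{N_i}` as
`∀ j, p^j c_i ∈ ker loc_λ ↔ N_i ≤ j` ⟺ (`p^{N_i} c_i ∈ ker` ∧ `p^{N_i−1} c_i ∉ ker`). HONEST FRAMING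
(programme `bsd-jet` §HONESTY, verbatim): «no tranche here proves BSD»; this removes ONE named print
input ([McC] Cor. 3.2) from the road-K input list of register row D5 `JET@p∣N`; 0 classes move.
References: [cite: McCallumLMS1991, §3 Prop. 3.1, Cor. 3.2 (pp. 298–299); §4 (pp. 299–300: "The
last two conditions are equivalent to Frob(l) = Frob(∞) on ℚ(E_{p^M})")]
[cite: GrossLMS1991, §3 (3.1)–(3.3)] [cite: WZhang2014, Notations (xii)].
-/

set_option autoImplicit false

noncomputable section

open scoped Classical

open WeierstrassCurve NumberField IsDedekindDomain Literature.NumberTheory.EllipticCurves.ModularForms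

namespace Literature.NumberTheory.EllipticCurves.McCallum1991

/-- **`Frob(ℓ) = Frob(∞)` on `K(E_{p^M})` gives Zhang's congruence form** `M ≤ M(ℓ)` (`p^M ∣ ℓ + 1`,
`p^M ∣ a_ℓ`) for a globally minimal `W` with good reduction at `ℓ` (here: `ℓ ∤ N_E`), `ℓ ≠ p`, `M ≥ 1`
— McCallum 1991, §4 (p. 300): *"this implies that `p^M` divides both `l + 1` and `a_l`"*.
[cite: McCallumLMS1991, §4 (pp. 299–300)] [cite: WZhang2014, Notations (xii)] -/
theorem le_kolyvaginIndex_of_frobEqFrobInfty (W : WeierstrassCurve ℚ) [W.IsElliptic]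
    [W.IsGloballyMinimal] (K : Type) [Field K] [NumberField K] {p : ℕ} (hp : p.Prime) {M : ℕ}
    (hM : 1 ≤ M) {ℓ : ℕ} (hℓ : ℓ.Prime) (hℓp : ℓ ≠ p) (hℓN : ¬ ℓ ∣ W.conductorNorm ℤ)
    (hfrob : FrobEqFrobInfty W K (p ^ M) ℓ) : M ≤ Zhang2014.kolyvaginIndex W p ℓ := by
  haveI : Fact p.Prime := ⟨hp⟩
  set v : HeightOneSpectrum (𝓞 ℚ) := (Rat.HeightOneSpectrum.primesEquiv (R := 𝓞 ℚ)).symm ⟨ℓ, hℓ⟩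
    with hv
  have hℓv : (ℓ : 𝓞 ℚ) ∈ v.asIdeal := (natCast_mem_asIdeal_iff_eq_primesEquiv_symm v hℓ).mpr hv
  have hpe : (Rat.HeightOneSpectrum.primesEquiv (R := 𝓞 ℚ) v : ℕ) = ℓ := by
    rw [hv, Equiv.apply_symm_apply]
  have hgood : W.HasGoodReductionAt v :=
    hasGoodReductionAt_of_not_dvd_conductorNorm W v (by rw [hpe]; exact hℓN)
  have h1 : p ^ M ∣ ℓ + 1 := pow_dvd_add_one_of_frobEqFrobInfty W (K := K) hp hM hℓ hℓp hfrob
  have h2 : ((p : ℤ) ^ M) ∣ W.frobeniusTrace ℓ := by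
    have h := pow_dvd_frobeniusTraceAt_of_frobEqFrobInfty W (K := K) hp hM hℓ hℓp hfrob hℓv hgood
    rwa [frobeniusTraceAt_eq_frobeniusTrace W v, hpe] at h
  exact Zhang2014.le_kolyvaginIndex_iff.mpr ⟨h1, by exact_mod_cast h2⟩

/-- Local-order bookkeeping: in an additive group, for a subgroup `H`, a prime `p` and an element `x`,
`p^N x ∈ H` together with (`N ≠ 0 → p^{N−1} x ∉ H`) says exactly `∀ j, p^j x ∈ H ↔ N ≤ j` — the two
renderings of McCallum's *"`ord c_{i,λ} = p^{N_i}`"*. [cite: McCallumLMS1991, §3 Cor. 3.2 (p. 299)] -/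
theorem forall_pow_zsmul_mem_iff_of_mem_of_not_mem {G : Type*} [AddCommGroup G] (H : AddSubgroup G)
    {p : ℕ} {N : ℕ} {x : G} (hmem : ((p : ℤ) ^ N) • x ∈ H)
    (hnot : N ≠ 0 → ((p : ℤ) ^ (N - 1)) • x ∉ H) (j : ℕ) :
    ((p ^ j : ℕ) : ℤ) • x ∈ H ↔ N ≤ j := by
  constructor
  · intro hj
    by_contra hlt
    have hlt : j < N := Nat.lt_of_not_le hlt
    apply hnot (by omega)
    have : ((p : ℤ) ^ (N - 1)) • x = ((p : ℤ) ^ (N - 1 - j)) • (((p ^ j : ℕ) : ℤ) • x) := by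
      rw [smul_smul, Nat.cast_pow, ← pow_add, Nat.sub_add_cancel (by omega)]
    rw [this]
    exact H.zsmul_mem hj _
  · intro hNj
    have : ((p ^ j : ℕ) : ℤ) • x = ((p : ℤ) ^ (j - N)) • (((p : ℤ) ^ N) • x) := by
      rw [smul_smul, Nat.cast_pow, ← pow_add, Nat.sub_add_cancel hNj]
    rw [this]
    exact H.zsmul_mem hmem _

/-- **McCallum 1991, Cor. 3.2 at level `p^M` for `τ`-eigenclasses — the named fact
`cor32_eigenclasses_infinite_primes_localOrder` HOLDS.** Proof: the tree's
`McCallum1991_cor_3_2_pow_of_chebotarev` (Čebotarev density theorem `Automorphic.chebotarev_artinRep_holds`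
+ Weil pairing `exists_weilPairing_holds`; image hypothesis only mod `p`, so the fact's `p`-adic tower is
more than enough), applied above every bound `max b N_E` (so that `ℓ ∤ N_E` and `W` has good reduction at
`ℓ`), with the bookkeeping (i)–(iv) of the module docstring.
[cite: McCallumLMS1991, §3 Prop. 3.1, Cor. 3.2 (pp. 298–299); §4 (pp. 299–300)]
[cite: GrossLMS1991, §3 (3.1)–(3.3)] -/
theorem cor32_eigenclasses_infinite_primes_localOrder_holds :
    cor32_eigenclasses_infinite_primes_localOrder := by
  intro N _ W _ _ _ K _ _ hK p hp hp2 htower c hc M hM r cs h0 hτ hind Mi hMi Nv hNv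
  haveI : Fact p.Prime := ⟨hp⟩
  have hρ : W.HasSurjectiveModNGaloisRep p := by simpa using htower 1
  have hW : W.exists_weilPairing p := W.exists_weilPairing_holds p
  -- `N_i ≤ M_i` as `p^{N_i - 1} c_i ≠ 0`
  have hN : ∀ i, Nv i ≠ 0 → ((p : ℤ) ^ (Nv i - 1)) • cs i ≠ 0 := by
    intro i hi h
    have hdvd : addOrderOf (cs i) ∣ p ^ (Nv i - 1) := by
      apply addOrderOf_dvd_of_nsmul_eq_zero
      rw [← natCast_zsmul]
      exact_mod_cast h
    rw [hMi i, Nat.pow_dvd_pow_iff_le_right hp.one_lt] at hdvd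
    have := hNv i
    omega
  -- independence in the `a_i c_i = 0` form
  have hind' : ∀ a : Fin r → ℤ, ∑ i, a i • cs i = 0 → ∀ i, a i • cs i = 0 := fun a ha i ↦
    addOrderOf_dvd_iff_zsmul_eq_zero.mp (hind a ha i)
  -- above every bound there is a good prime
  refine Set.infinite_of_forall_exists_gt fun b ↦ ?_
  obtain ⟨ℓ, hbℓ, hKol, hfrob, hloc⟩ :=
    McCallum1991_cor_3_2_pow_of_chebotarev (W := W) (K := K) (N := N)
      Literature.NumberTheory.Automorphic.chebotarev_artinRep_holds hK hp hp2 hρ hW hM hc cs h0 Nv hN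
      hτ hind' (max b (W.conductorNorm ℤ))
  obtain ⟨hℓP, hℓN, hℓD, hℓp, hprime, -⟩ := hKol
  have hbℓ' : b < ℓ := lt_of_le_of_lt (le_max_left _ _) hbℓ
  have hℓNE : ¬ ℓ ∣ W.conductorNorm ℤ := fun h ↦ by
    have := Nat.le_of_dvd (W.conductorNorm_pos_holds) h
    have := lt_of_le_of_lt (le_max_right b _) hbℓ
    omega
  have hidx : M ≤ Zhang2014.kolyvaginIndex W p ℓ :=
    le_kolyvaginIndex_of_frobEqFrobInfty W K hp hM hℓP hℓp hℓNE hfrob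
  refine ⟨ℓ, ⟨hfrob, ⟨hℓP, hℓN, hℓD, hℓp, hprime, lt_of_lt_of_le (by omega) hidx⟩, hidx, ?_⟩, hbℓ'⟩
  intro i v hv j
  exact forall_pow_zsmul_mem_iff_of_mem_of_not_mem _ (hloc i v hv).1 (hloc i v hv).2 j

end Literature.NumberTheory.EllipticCurves.McCallum1991

end
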